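import Summits.ResolutionOfSingularities.ResolutionOfSingularities.Theses.DefectlessFrames
import Summits.ResolutionOfSingularities.ResolutionOfSingularities.Theorems.DefectlessFramesDefectlessFramesRefutation
import Mathlib.RingTheory.Jacobson.Ring

/-!
# Negative lemmas for crux `ZariskiCMEngine` (stmt-ResolutionOfSingularities-17922):
# load-bearing hypotheses of its target `RankOneZeroDimUniformization`

Load-bearing analysis (cdisprove cycle 1, §2 of `Cruxes/ZariskiCMEngine/Disproof.lean`). The crux
is `DefectlessFramesR → PureTranscendentalFrames → RankOneZeroDimUniformization`; its conclusion
is summit-implied, so the only hypotheses whose removal can be SHOWN to matter are binders of the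
target itself. At the rank-one zero-dimensional witness `k = 𝔽₂`, `K = 𝔽₂(X)`,
`O = 𝔽₂[X]_{(X)}` (the tree's `DefectlessFramesRefutation.OX`):

* `not_rankOneZeroDimUniformization_without_rfg` — finite generation of the PRESCRIBED algebra
  `R` is load-bearing: with `R = O`, a finitely generated `A`, `O ≤ A ⊆ O`, makes `O` a finitely
  generated `𝔽₂`-algebra, hence Jacobson; a local domain that is Jacobson has maximal ideal
  `Jac(⊥) = ⊥`, but `X` is a non-zero non-unit. (The trivial-valuation witness of the sibling
  `PatchingRel/Negative/LUrelWithoutRFG.lean` is excluded here by `RankOne ∋ IsNontrivial`.)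
* `not_rankOneZeroDimUniformization_without_rle` — `R ⊆ O` is load-bearing (trivially):
  `R = 𝔽₂[X⁻¹]` (`X⁻¹ ∉ O` is `inv_X_not_mem_OX` of the sibling file
  `AttainedDistanceOfDefectlessFalse.lean`, inlined here).
* `rankOne_hyps_false_of_isAlgebraic` — the corner `K/k` ALGEBRAIC of the target (and the `n = 0`
  corner of the repaired lever `DefectlessFramesR`, where `f ≠ 0` forces `K = k(z)` algebraic) is
  EMPTY: `O ⊇ k` is then all of `K` (integrally closed), so its valuation is trivial and admits no
  `RankOne` structure. Certifies the rev-3 repair: no degenerate-dimension refutation exists.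
-/

set_option linter.dupNamespace false

open scoped Polynomial
open IsDedekindDomain.HeightOneSpectrum

namespace Summit.ResolutionOfSingularities.ResolutionOfSingularities.Theorems.ZariskiCMEngine.Negative

open Summit.ResolutionOfSingularities.ResolutionOfSingularities.Theorems.DefectlessFramesRefutation

noncomputable section

/-! ### The witness `𝔽₂(X)`, `X`-adic (facts extracted from the tree refutation's proof) -/

/-- `X ∈ O`. [folklore] -/
theorem X_mem_OX : (RatFunc.X : KW) ∈ OX := by
  rw [Valuation.mem_valuationSubring_iff]
  change vX RatFunc.X ≤ 1
  rw [Polynomial.valuation_X_eq_neg_one, ← WithZero.exp_zero, WithZero.exp_le_exp]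
  decide

/-- Constants lie in `O`. [folklore] -/
theorem const_mem_OX : ∀ c : kW, algebraMap kW KW c ∈ OX := by
  intro c
  rw [Valuation.mem_valuationSubring_iff, IsScalarTower.algebraMap_apply kW kW[X] KW]
  exact valuation_le_one _ _

/-- The valuation of `O` is equivalent to the `X`-adic valuation. [folklore] -/
theorem isEquiv_OX : vX.IsEquiv OX.valuation := Valuation.isEquiv_valuation_valuationSubring _

/-- `O` is of rank one. [folklore] -/
theorem rankOne_OX : Nonempty OX.valuation.RankOne := by
  haveI : OX.valuation.IsNontrivial := by
    refine ⟨RatFunc.X, ?_, ?_⟩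
    · simp [RatFunc.X_ne_zero]
    · intro h1
      have := (isEquiv_OX.symm.eq_one_iff_eq_one).mp h1
      simp [Polynomial.valuation_X_eq_neg_one] at this
  rw [Valuation.nonempty_rankOne_iff_mulArchimedean]
  haveI h1 : MulArchimedean (MonoidWithZeroHom.ValueGroup₀ (.ofClass vX)) :=
    MulArchimedean.comap MonoidWithZeroHom.ValueGroup₀.embedding.toMonoidHom
      MonoidWithZeroHom.ValueGroup₀.embedding_strictMono
  exact MulArchimedean.comap (isEquiv_OX.symm.orderMonoidIso).toMonoidHom
    (isEquiv_OX.symm.orderMonoidIso).strictMono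

/-- `O` is zero-dimensional (every element of `O` is congruent to a constant modulo `𝔪_O`).
[folklore] -/
theorem zeroDim_OX : ∀ x ∈ OX, ∃ f : Polynomial kW, f ≠ 0 ∧ Polynomial.aeval x f ∈ OX.nonunits := by
  intro x hx
  rw [Valuation.mem_valuationSubring_iff] at hx
  have hd : x.denom ≠ 0 := RatFunc.denom_ne_zero x
  have hd' : algebraMap kW[X] KW x.denom ≠ 0 := RatFunc.algebraMap_ne_zero hd
  have hd0 : x.denom.coeff 0 ≠ 0 := by
    intro h0
    have hXd : Polynomial.X ∣ x.denom := Polynomial.X_dvd_iff.mpr h0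
    have hvd : (Polynomial.idealX kW).intValuation x.denom < 1 :=
      (intValuation_lt_one_iff_mem _ _).mpr
        (by rw [Polynomial.idealX_span]; exact Ideal.mem_span_singleton.mpr hXd)
    have hXn : ¬ Polynomial.X ∣ x.num := by
      intro hXn
      obtain ⟨a, b, hab⟩ := RatFunc.isCoprime_num_denom x
      have : Polynomial.X ∣ (1 : kW[X]) := hab ▸ dvd_add (dvd_mul_of_dvd_right hXn a)
        (dvd_mul_of_dvd_right hXd b)
      exact Polynomial.not_isUnit_X (isUnit_of_dvd_one this)
    have hvn : (Polynomial.idealX kW).intValuation x.num = 1 :=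
      intValuation_eq_one_iff.mpr
        (by rw [Polynomial.idealX_span]; exact fun h => hXn (Ideal.mem_span_singleton.mp h))
    have hvx : vX x = 1 / (Polynomial.idealX kW).intValuation x.denom := by
      conv_lhs => rw [← RatFunc.num_div_denom x]
      rw [map_div₀, valuation_of_algebraMap, valuation_of_algebraMap, hvn]
    have hpos : 0 < (Polynomial.idealX kW).intValuation x.denom :=
      zero_lt_iff.mpr (intValuation_ne_zero _ _ hd)
    have : 1 < vX x := by
      rw [hvx, one_div, one_lt_inv₀ hpos]; exact hvd
    exact absurd hx (not_le.mpr this)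
  have hvd : (Polynomial.idealX kW).intValuation x.denom = 1 :=
    intValuation_eq_one_iff.mpr (by
      rw [Polynomial.idealX_span]
      exact fun h => hd0 (Polynomial.X_dvd_iff.mp (Ideal.mem_span_singleton.mp h)))
  set c : kW := x.num.coeff 0 / x.denom.coeff 0 with hc
  refine ⟨Polynomial.X - Polynomial.C c, Polynomial.X_sub_C_ne_zero c, ?_⟩
  rw [ValuationSubring.mem_nonunits_iff, ← isEquiv_OX.lt_one_iff_lt_one]
  simp only [map_sub, Polynomial.aeval_X, Polynomial.aeval_C]
  have hx' : x - algebraMap kW KW c =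
      algebraMap kW[X] KW (x.num - Polynomial.C c * x.denom) / algebraMap kW[X] KW x.denom := by
    rw [map_sub, map_mul, sub_div, mul_div_assoc, div_self hd', mul_one,
      IsScalarTower.algebraMap_apply kW kW[X] KW c, Polynomial.algebraMap_eq, RatFunc.num_div_denom]
  rw [hx', map_div₀, valuation_of_algebraMap, valuation_of_algebraMap, hvd, div_one,
    intValuation_lt_one_iff_mem, Polynomial.idealX_span, Ideal.mem_span_singleton,
    Polynomial.X_dvd_iff]
  simp [hc, div_mul_cancel₀ _ hd0]

/-- `K = k(X)` is finitely generated over `k`. [folklore] -/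
theorem fg_top : (⊤ : IntermediateField kW KW).FG := ⟨{RatFunc.X}, by simp [RatFunc.adjoin_X]⟩

/-! ### The three lemmas -/

/-- **`R.FG` is load-bearing in `RankOneZeroDimUniformization`** (the target of crux
`ZariskiCMEngine`): relative local uniformization at rank-one zero-dimensional valuation rings
demanded for ALL `k`-subalgebras `R ⊆ O` is false — witness `k = 𝔽₂`, `K = 𝔽₂(X)`,
`O = 𝔽₂[X]_{(X)}`, `R = O`. [folklore] -/
theorem not_rankOneZeroDimUniformization_without_rfg :
    ¬ ∀ p : ℕ, p.Prime → ∀ (k K : Type) [Field k] [CharP k p] [PerfectField k] [Field K]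
      [Algebra k K], (⊤ : IntermediateField k K).FG → ∀ O : ValuationSubring K,
        (∀ c : k, algebraMap k K c ∈ O) → Nonempty O.valuation.RankOne →
          (∀ x ∈ O, ∃ f : Polynomial k, f ≠ 0 ∧ Polynomial.aeval x f ∈ O.nonunits) →
            ∀ R : Subalgebra k K, R.toSubring ≤ O.toSubring →
              ∃ (A : Subalgebra k K) (h : A.toSubring ≤ O.toSubring), R ≤ A ∧ A.FG ∧
                IsFractionRing A K ∧ IsRegularLocalRing (Localization.AtPrime
                  (Ideal.comap (Subring.inclusion h) (IsLocalRing.maximalIdeal O))) := by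
  intro H
  let OXalg : Subalgebra kW KW := { OX.toSubring with algebraMap_mem' := const_mem_OX }
  obtain ⟨A, hA, hle, hAfg, -, -⟩ :=
    H 2 Nat.prime_two kW KW fg_top OX const_mem_OX rankOne_OX zeroDim_OX OXalg (fun _ hx => hx)
  -- `A = O` as sets
  have hAO : ∀ x : KW, x ∈ A ↔ x ∈ OX :=
    fun x => ⟨fun hx => hA (A.mem_toSubring.mpr hx), fun hx => hle (show x ∈ OXalg from hx)⟩
  -- `↥A` is a finitely generated `𝔽₂`-algebra, hence a Jacobson ring
  haveI : Algebra.FiniteType kW A := A.fg_iff_finiteType.mp hAfg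
  haveI : IsJacobsonRing A := isJacobsonRing_of_finiteType (A := kW)
  -- valuation bookkeeping on `↥A`
  have hvle : ∀ a : A, OX.valuation (a : KW) ≤ 1 :=
    fun a => (OX.valuation_le_one_iff _).mpr ((hAO _).mp a.2)
  have hlt_of_nonunit : ∀ a : A, ¬ IsUnit a → OX.valuation (a : KW) < 1 := by
    intro a ha
    by_contra hlt
    have h1 : OX.valuation (a : KW) = 1 := le_antisymm (hvle a) (not_lt.mp hlt)
    have ha0 : (a : KW) ≠ 0 := by
      intro h0; rw [h0, map_zero] at h1; exact zero_ne_one h1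
    have hinv : (a : KW)⁻¹ ∈ A := by
      rw [hAO, ← OX.valuation_le_one_iff, map_inv₀, h1, inv_one]
    exact ha (IsUnit.of_mul_eq_one ⟨(a : KW)⁻¹, hinv⟩ (Subtype.ext (mul_inv_cancel₀ ha0)))
  have nonunit_of_lt : ∀ a : A, OX.valuation (a : KW) < 1 → ¬ IsUnit a := by
    intro a ha hu
    obtain ⟨b, hb⟩ := hu.exists_right_inv
    have hab : OX.valuation (a : KW) * OX.valuation (b : KW) = 1 := by
      rw [← map_mul, ← Subalgebra.coe_mul, hb, Subalgebra.coe_one, map_one]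
    have : OX.valuation (a : KW) * OX.valuation (b : KW) < 1 :=
      calc OX.valuation (a : KW) * OX.valuation (b : KW)
          ≤ OX.valuation (a : KW) * 1 := mul_le_mul_right (hvle b) _
        _ = OX.valuation (a : KW) := mul_one _
        _ < 1 := ha
    exact this.ne hab
  -- hence `↥A` is local …
  haveI : IsLocalRing A := by
    refine IsLocalRing.of_nonunits_add fun a b ha hb => ?_
    rw [mem_nonunits_iff] at ha hb ⊢
    refine nonunit_of_lt _ (lt_of_le_of_lt (OX.valuation.map_add (a : KW) (b : KW)) ?_)
    exact max_lt (hlt_of_nonunit a ha) (hlt_of_nonunit b hb)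
  -- … with maximal ideal `Jac(⊥) = ⊥`
  have hmax : IsLocalRing.maximalIdeal A = ⊥ :=
    (IsLocalRing.jacobson_eq_maximalIdeal (⊥ : Ideal A) bot_ne_top).symm.trans
      (IsJacobsonRing.out ‹_› Ideal.isPrime_bot.isRadical)
  -- but `X` is a non-zero non-unit of `A`
  let XA : A := ⟨RatFunc.X, (hAO _).mpr X_mem_OX⟩
  have hXlt : OX.valuation (XA : KW) < 1 := by
    rw [← isEquiv_OX.lt_one_iff_lt_one]
    change vX RatFunc.X < 1
    rw [Polynomial.valuation_X_eq_neg_one, ← WithZero.exp_zero, WithZero.exp_lt_exp]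
    decide
  have hXmem : XA ∈ IsLocalRing.maximalIdeal A :=
    (IsLocalRing.mem_maximalIdeal _).mpr (mem_nonunits_iff.mpr (nonunit_of_lt XA hXlt))
  rw [hmax, Ideal.mem_bot] at hXmem
  exact RatFunc.X_ne_zero (congrArg Subtype.val hXmem)

/-- **`R ⊆ O` is load-bearing in `RankOneZeroDimUniformization`** (trivially): the finitely
generated `R = 𝔽₂[X⁻¹]` at the same witness sits below no `A ⊆ O`. [folklore] -/
theorem not_rankOneZeroDimUniformization_without_rle :
    ¬ ∀ p : ℕ, p.Prime → ∀ (k K : Type) [Field k] [CharP k p] [PerfectField k] [Field K]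
      [Algebra k K], (⊤ : IntermediateField k K).FG → ∀ O : ValuationSubring K,
        (∀ c : k, algebraMap k K c ∈ O) → Nonempty O.valuation.RankOne →
          (∀ x ∈ O, ∃ f : Polynomial k, f ≠ 0 ∧ Polynomial.aeval x f ∈ O.nonunits) →
            ∀ R : Subalgebra k K, R.FG →
              ∃ (A : Subalgebra k K) (h : A.toSubring ≤ O.toSubring), R ≤ A ∧ A.FG ∧
                IsFractionRing A K ∧ IsRegularLocalRing (Localization.AtPrime
                  (Ideal.comap (Subring.inclusion h) (IsLocalRing.maximalIdeal O))) := by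
  intro H
  obtain ⟨A, hA, hle, -, -, -⟩ :=
    H 2 Nat.prime_two kW KW fg_top OX const_mem_OX rankOne_OX zeroDim_OX
      (Algebra.adjoin kW {(RatFunc.X : KW)⁻¹})
      (Subalgebra.fg_def.mpr ⟨{(RatFunc.X : KW)⁻¹}, Set.finite_singleton _, rfl⟩)
  have h1 : (RatFunc.X : KW)⁻¹ ∈ A := hle (Algebra.subset_adjoin (Set.mem_singleton _))
  -- `X⁻¹ ∉ O` (landed separately as `Negative.inv_X_not_mem_OX`; inlined to stay import-free)
  have hinv : (RatFunc.X : KW)⁻¹ ∉ OX := by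
    rw [Valuation.mem_valuationSubring_iff, map_inv₀]
    change ¬ (vX RatFunc.X)⁻¹ ≤ 1
    rw [Polynomial.valuation_X_eq_neg_one, ← WithZero.exp_neg, ← WithZero.exp_zero,
      WithZero.exp_le_exp]
    decide
  exact hinv (hA (A.mem_toSubring.mpr h1))

/-- **The algebraic corner is empty**: a valuation ring `O ⊇ k` of an ALGEBRAIC extension `K/k`
with a `RankOne` structure on its valuation does not exist (`O = K`, trivial valuation, while
Mathlib's `Valuation.RankOne` extends `IsNontrivial`). Hence the `trdeg 0` corner of the target of
`ZariskiCMEngine` and the `n = 0` corner of `DefectlessFramesR` (with `f ≠ 0`, `K = k(z)` is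
algebraic) are vacuous. [folklore] -/
theorem rankOne_hyps_false_of_isAlgebraic {k K : Type} [Field k] [Field K] [Algebra k K]
    [Algebra.IsAlgebraic k K] (O : ValuationSubring K) (hk : ∀ c : k, algebraMap k K c ∈ O)
    (hr : Nonempty O.valuation.RankOne) : False := by
  obtain ⟨hr⟩ := hr
  -- every element of `K` is integral over `k ⊆ O`, hence lies in `O` (integrally closed)
  have hO : ∀ x : K, x ∈ O := by
    intro x
    obtain ⟨f, hf, hfx⟩ := (Algebra.IsAlgebraic.isAlgebraic (R := k) x).isIntegral
    let ι : k →+* O :=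
      { toFun := fun c => ⟨algebraMap k K c, hk c⟩
        map_one' := Subtype.ext (by simp)
        map_mul' := fun _ _ => Subtype.ext (by simp)
        map_zero' := Subtype.ext (by simp)
        map_add' := fun _ _ => Subtype.ext (by simp) }
    obtain ⟨y, hy⟩ := IsIntegrallyClosed.algebraMap_eq_of_integral
      (⟨f.map ι, hf.map ι, by rw [Polynomial.eval₂_map]; exact hfx⟩ : IsIntegral O x)
    exact hy ▸ y.2
  -- so the valuation is trivial, contradicting `RankOne ∋ IsNontrivial`
  obtain ⟨x, hx0, hx1⟩ := hr.toIsNontrivial.exists_val_nontrivial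
  have hle : O.valuation x ≤ 1 := (O.valuation_le_one_iff x).mpr (hO x)
  have hge : 1 ≤ O.valuation x := by
    have := (O.valuation_le_one_iff x⁻¹).mpr (hO x⁻¹)
    rw [map_inv₀] at this
    exact (inv_le_one₀ (zero_lt_iff.mpr hx0)).mp this
  exact hx1 (le_antisymm hle hge)

end

end Summit.ResolutionOfSingularities.ResolutionOfSingularities.Theorems.ZariskiCMEngine.Negative
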